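import Summits.QuantumFields.YangMills.Theorems.BalabanUVNodesK0Stub1SectFChartBlockAtRecord
import Summits.QuantumFields.YangMills.Theorems.BalabanUVNodesK0Stub1QlinSupLetter
import Summits.QuantumFields.YangMills.Theorems.BalabanUVNodesK0Stub1OneStepCollarOfAdm22
import Summits.QuantumFields.YangMills.Theorems.BalabanUVNodesK0Stub1SectFWSlotOneLevel
import HarnessLib

/-!
# K0⁷ STUB 1 (`stub_prop8StepCoP13`), sub-target S4b «the (δ∕δA′)V pieces at objects» — THE CHART BLOCK OF THE SECT. F CAPSTONE AT THE RECORD, part 6 (closing):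
# **THE W-SLOT OF SECT. F's `W = (δ∕δA′)V` AT THE RECORD's TRUE CONSTRAINT, MODULO FOUR NUMERIC LETTERS** — the capstone
# `K0Stub1SectFWSlotOneLevel.exists_sectF_W_levOf` APPLIED at every torus `P` (`4 ≤ d`), height `k`, (2.2)-admissible nested family, every right inverse `H` of the true
# linearisation `Qlin` carrying BOTH (46) rows, fibre `M_N(ℂ)`: every STRUCTURAL hypothesis (`hcollar hw hρ hτ hτs hτ1 hBE hB hM hQt hHt hD hDt hDdiff hDtdiff hwB`) and
# the letters `h55`, `hQ`, `h57` (BOTH halves — (57) and (58)) are supplied by THEOREMS (parts 1–5, the capstone's own calculus, dag-n07-w2's chart), the operators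
# `Qᵗ`, `Hᵗ`, `D(·)` (analytic), `𝔇 = fderiv D`, `𝔇ᵗ` are DELIVERED, and what remains displayed is quantified INSIDE the conclusion: a free output block weight `wB′` (absorbing (66)'s volume factors) and FOUR numbers `O₁` ((3.132)
# for the multiplier `M`), `q₀` (column letter of `Qᵗ`), `θ₀` ((73)ᵀ for `𝔇ᵗ`), `h₀` ((46)ᵀ for `Hᵗ`) — plus the averaging letter `q` in the any-`Q` edition

Cell `pub-ymgap`, width seat `pub-ymgap-k0-s1-w2` g3 (CLAIM-1 closing file, INTENT-6).  `--kind proof --supports stmt-QuantumFields-20541 --as helper`; count-neutral.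
[15] = [Balaban1985Variational]; [B6] = [Balaban1984PropagatorsII].

WHY.  This is the junction certificate of the S4b lane at the TRUE constraint: the g0∕g2∕g3 files of this seat and the neighbours' files COMPOSE — binder shapes, weights,
pairings, carriers and instance paths agree — so that Prop. 4's W-slot for Sect. F's `W` at the record is ONE theorem whose displayed inputs are numbers about explicitly
delivered operators.  `H` is a PARAMETER with its two (46) rows (sup row `B₀`, gradient row `B₁`): dag k0-s1-w1's `K0Stub1RecordAveragingRightInverse.exists_rightInverse_
chartLog_of_flatH` (p604736) supplies it with the sup row from P2's flat `H₀`; the route `UnitScaleTilt`'s `ChartHInv.exists_rightInverse₂` carries the gradient row as well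
(the record wrapper with both rows is the one located follow-up of this file).  With the gradient row, (58) — the gradient half of the capstone's `h57` — is PROVED here:
`∇(A′ − HD(A′)) = ∇A′ − ∇H·D(A′)`, `|D(A′)| ≤ 4C₂r²` (55).  The multiplier `M` and the average `Q` of the `H`-terms `½B(D, MD) − B(QA′, MD)` are parameters (intended:
`M := η^d • M_V`, `M_V` = p598821's flat `((QGQ*)⁻¹ − a)_V` — dag k0-s1-w4's LOCATED-M-NORMALISATION (bus 2026-08-28 06:55Z; certificate file
`…K0Stub1MultiplierNormalisation`: `BE A′ ((∂*∂H)_V X) = B (Q_V A′) ((η^d•M_V) X)`, `Qᵗ_V∘(η^d•M_V) = (∂*∂H)_V`) — and `Q = Qlin` (the headline edition) or whichever average the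
(87)∕(128) junction at the record selects under plan's road R0′).

WHAT IS PROVED (sorry-free; no definition; axioms standard).
* `fibreSlotConst_le_of_letterBounds` — the fibre constant of g0's multi-level V₀-slot under `‖ρℓ‖ ≤ M_ρ‖ℓ‖`, `‖τX‖ ≤ ‖X‖` (generic fibre; keeps matrix op-norm instances out).
* ★★ `exists_sectF_W_atRecord_of_numericLetters_anyQ` — the W-slot with the average `Q` of the multiplier term a PARAMETER (five numbers: `O₁ q₀ θ₀ h₀` + the averaging
  letter `q` of `Q`).
* ★★★ `exists_sectF_W_atRecord_of_numericLetters` — the headline edition `Q := Qlin` (FOUR numbers; `q = 240ℓ₀L` by part 4 `letterQ_Qlin_of_adm22`, `ℓ₀ = (d+2)L`):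
  PARAMETERS (inhabited in the tree): the right inverse `H` of `Qlin` with `hHinv`, sup row `B₀`, gradient row `B₁`; the fibre letters `τ ρ` (g0's `exists_fibreLetters`, `M_ρ =
  N³`); the pairings `BE` = (27), `B` = block trace pairing (symmetric) and a `B`-symmetric multiplier `M` (p598821's `M_V` scaled by `η^d`, dag k0-s1-w4); the `ε`-window `18C₂B₀ε ≤ 1`, `64ε ≤ R⋆` (dag-n07-w2's
  `exists_eps_chartDDeriv`).  CONCLUSION: `∃ Qt Ht Dfun Dt` with `hQt`, `hHt`, (55)∕(49)∕(48) on the sup-ball, `ContDiffOn ℂ ω Dfun`, `hDt`; and `∀ O₁ q₀ θ₀ h₀ ℓ`,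
  `0 ≤ O₁ θ₀ h₀`, `1 + 4B₀C₂ε ≤ ℓ`, `1 + 4B₁C₂ε ≤ ℓ`, `ℓε ≤ 1/16` + the four letters ⇒ `∃ e W`: (i) the (63)-certificate `D[½B(Dfun A, M Dfun A) − B(Qlin A, M Dfun A) +
  V₀(A − H Dfun A)](A′) = BE (W A′)` on the two-size `ε`-ball; (ii) `hWd` there; (iii) `hWq`: `w 3 b·‖W Y b‖ ≤ C₄r²`, `C₄ = θ₀O₁(4C₂ε + 240ℓ₀L) + 4q₀O₁C₂ + (1 + θ₀εh₀)·(d−1)L⁶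
  M_ρ(200 + 2L²)·ℓ²`.
HONEST SCOPE ∕ WHAT THIS IS NOT.  (1) The four (five) numbers are HYPOTHESES, quantified together with a FREE output block weight `wB′` (port ∕ kernel lanes: dag k0-s1-w4's OFFER-1 of
2026-08-28 06:30Z takes `O₁` and the flat `q₀`, `h₀`).  (2) Whether `V` with (`Q`, `H`, `M`) IS the Sect. F functional `𝔊(A′) − ½⟨A′, Δ_aA′⟩` at the record is the (87)∕(128) junction of S2∕S4a — NOT asserted; this
file is the (δ∕δA′)-calculus side only.  (3) Nothing of [15] Sects. D–F's analysis is asserted; `stub_prop8StepCoP13` ∕ K0⁷ NOT closed; N07 NOT discharged; counts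
unmoved (28∕28 · 5∕27); one finite 𝕋⁴ programme at fixed ε — R4 closes the conditional finite-𝕋⁴ rung `BalabanLadder.UV` only, never the summit; the YM mass gap (Clay)
is NOT proved by any of this; nothing continuum ∕ ℝ⁴ ∕ OS.  No `sorry`, no `def`, no `instance`, no `notation`.

References: [15] (27) p.282, (45)–(50) p.285, (55)–(58) pp.286–287, (63)–(73) pp.287–289, (80) p.290, (87)–(90) p.291, Prop. 4 (97)–(98) pp.292–293, (115) p.294,
(157)–(158) p.302; [B6] (2.2) p.224, (2.35) p.228, Cor. 2.8 p.249.
-/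

noncomputable section

open scoped BigOperators Matrix.Norms.L2Operator Topology ContDiff
open NormedSpace Metric Set Filter

namespace Summit.QuantumFields.YangMills.Theorems.K0Stub1SectFWSlotAtRecord

open Literature.MathematicalPhysics.QuantumFieldTheory.Balaban1983to89
open Literature.MathematicalPhysics.QuantumFieldTheory.Balaban1983to89.B6SectADomainsV1 (Domains)
open Literature.MathematicalPhysics.QuantumFieldTheory.Balaban1983to89.B6SectAOperatorsV1 (BondIdx)
open B4Sect5Torus (TSite)
open B9Eq39Adjoint (bondPair)
open B11Eq26ActionExpansion (V0)
open Summit.QuantumFields.YangMills.Theorems.FlatCubeOpsText (Adm22)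
open Summit.QuantumFields.YangMills.Theorems.K0FlatCubeOpsTextP (IsLevWeight)
open Summit.QuantumFields.YangMills.Theorems.Prop8Chart (chartLog)
open Summit.QuantumFields.YangMills.Theorems.K0Stub1SectFWSlotOneLevel (exists_sectF_W_levOf)
open Summit.QuantumFields.YangMills.Theorems.K0Stub1TransposesByDualiser (exists_capstoneTransposes)
open Summit.QuantumFields.YangMills.Theorems.K0Stub1ChartDAnalytic (exists_analytic_chartD_of_rightInverse)
open Summit.QuantumFields.YangMills.Theorems.K0Stub1SectFChartBlockAtRecord (chartBlock_of_solution)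
open Summit.QuantumFields.YangMills.Theorems.K0Stub1QlinSupLetter (letterQ_Qlin_of_adm22)
open Summit.QuantumFields.YangMills.Theorems.K0Stub1OneStepCollarOfAdm22 (oneStepCollar_of_adm22)

variable {P : Params}

/-! ## §0  The fibre constant under letter bounds (generic fibre; keeps matrix-norm instances out of the record theorems) -/

/-- **g0's multi-level V₀-constant under the fibre letter bounds**: with `‖ρℓ‖ ≤ M_ρ‖ℓ‖` and `‖τX‖ ≤ ‖X‖`,
`64·d′·L₆·‖ρ‖ + d′·L₆·(136 + 2L₂)·‖ρ‖‖τ‖ ≤ d′·L₆·M_ρ·(200 + 2L₂)`, inserted in the capstone's `C₄·r²` (all other factors non-negative). [folklore] -/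
theorem fibreSlotConst_le_of_letterBounds {𝔸 : Type*} [NormedRing 𝔸] [NormedAlgebra ℂ 𝔸] (ρ : (𝔸 →L[ℂ] ℂ) →L[ℂ] 𝔸) (τ : 𝔸 →L[ℂ] ℂ)
    {Mρ : ℝ} (hMρ : 0 ≤ Mρ) (hρM : ∀ ℓ', ‖ρ ℓ'‖ ≤ Mρ * ‖ℓ'‖) (hτ1 : ∀ X, ‖τ X‖ ≤ ‖X‖) {A dm1 L6 L2 Θ ℓ r : ℝ}
    (hdm1 : 0 ≤ dm1) (hL6 : 0 ≤ L6) (hL2 : 0 ≤ L2) (hΘ : 0 ≤ Θ) (hℓ : 0 ≤ ℓ ^ 2) (hr : 0 ≤ r ^ 2) :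
    (A + Θ * (64 * dm1 * L6 * ‖ρ‖ + dm1 * L6 * (136 + 2 * L2) * ‖ρ‖ * ‖τ‖) * ℓ ^ 2) * r ^ 2
      ≤ (A + Θ * (dm1 * L6 * Mρ * (200 + 2 * L2)) * ℓ ^ 2) * r ^ 2 := by
  have hρop : ‖ρ‖ ≤ Mρ := ContinuousLinearMap.opNorm_le_bound ρ hMρ hρM
  have hτop : ‖τ‖ ≤ 1 := ContinuousLinearMap.opNorm_le_bound τ zero_le_one fun X => by rw [one_mul]; exact hτ1 X
  have h1 : 64 * dm1 * L6 * ‖ρ‖ ≤ 64 * dm1 * L6 * Mρ := mul_le_mul_of_nonneg_left hρop (by positivity)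
  have h2 : dm1 * L6 * (136 + 2 * L2) * ‖ρ‖ * ‖τ‖ ≤ dm1 * L6 * (136 + 2 * L2) * Mρ * 1 :=
    mul_le_mul (mul_le_mul_of_nonneg_left hρop (by positivity)) hτop (norm_nonneg _) (by positivity)
  have hCV : 64 * dm1 * L6 * ‖ρ‖ + dm1 * L6 * (136 + 2 * L2) * ‖ρ‖ * ‖τ‖ ≤ dm1 * L6 * Mρ * (200 + 2 * L2) := by nlinarith [h1, h2]
  have h3 : Θ * (64 * dm1 * L6 * ‖ρ‖ + dm1 * L6 * (136 + 2 * L2) * ‖ρ‖ * ‖τ‖) * ℓ ^ 2 ≤ Θ * (dm1 * L6 * Mρ * (200 + 2 * L2)) * ℓ ^ 2 :=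
    mul_le_mul_of_nonneg_right (mul_le_mul_of_nonneg_left hCV hΘ) hℓ
  exact mul_le_mul_of_nonneg_right (by linarith) hr

/-! ## §1  ★★ The W-slot at the record, any average `Q` in the multiplier term (five numbers) -/
/-- ★★ **THE W-SLOT OF SECT. F's `W` AT THE RECORD, ANY AVERAGE `Q` IN THE MULTIPLIER TERM** (see the module docstring for the binder list; the transpose `Qt` of `Q`
is delivered by formula; the letters quantified inside are `O₁ q₀ θ₀ h₀` and the averaging letter `q` of `Q`; `ℓ ≥ 1 + 4B₀C₂ε`, `ℓ ≥ 1 + 4B₁C₂ε`, `ℓε ≤ 1/16`).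
[cite: Balaban1985Variational, Prop. 4 (97)-(98) pp.292-293, (157)-(158) p.302, (63) p.287, (87)-(90) p.291, (27) p.282, (45)-(50) p.285, (55)-(58) pp.286-287, (73) p.289; Balaban1984PropagatorsII, (2.2) p.224, Cor. 2.8 p.249] -/
theorem exists_sectF_W_atRecord_of_numericLetters_anyQ (N : ℕ) [NeZero N] (P : Params) (hd : 4 ≤ P.d) (k : ℕ)
    [Fact ((0 : ℝ) < (P.L : ℝ))] [Fact ((0 : ℝ) < ((P.L : ℝ))⁻¹ ^ k)]
    {R' M : ℕ} (hR'L : 2 * P.L ≤ R') (hM : 1 ≤ M) (Dm : Domains P) (hDk : Dm.k = k) (hAdm : Adm22 Dm R' M)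
    {w : ℕ → PBond P 0 → ℝ} (hw : IsLevWeight P k Dm w)
    -- the right inverse `H` of the true linearisation with BOTH (46) rows (dag k0-s1-w1's p604736 gives the sup row; UST `ChartHInv.exists_rightInverse₂` the gradient row)
    (H : (BondIdx Dm → Matrix (Fin N) (Fin N) ℂ) →ₗ[ℂ] (PBond P 0 → Matrix (Fin N) (Fin N) ℂ))
    (hHinv : ∀ X, (fderiv ℂ (chartLog (((P.L : ℝ)⁻¹) ^ k) Dm : (PBond P 0 → Matrix (Fin N) (Fin N) ℂ) → BondIdx Dm → Matrix (Fin N) (Fin N) ℂ) 0) (H X) = X)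
    {B₀ : ℝ} (hB₀ : 0 ≤ B₀)
    (hHB : ∀ (X : BondIdx Dm → Matrix (Fin N) (Fin N) ℂ) (t : ℝ), 0 ≤ t → (∀ i, ‖X i‖ ≤ t) → ∀ b, w 1 b * ‖H X b‖ ≤ B₀ * t)
    {B₁ : ℝ} (hB₁ : 0 ≤ B₁)
    (hHgrad : ∀ (X : BondIdx Dm → Matrix (Fin N) (Fin N) ℂ) (t : ℝ), 0 ≤ t → (∀ i, ‖X i‖ ≤ t) →
      ∀ (b : PBond P 0) (ν : Fin P.d), w 2 b * (P.L : ℝ) ^ k * ‖H X ⟨b.src.shift ν, b.dir⟩ - H X b‖ ≤ B₁ * t)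
    -- the `ε`-window of dag-n07-w2's `N07ChartDDerivative` for this `B₀`
    {ε : ℝ} (hε : 0 < ε) (h18 : 18 * (960 * (((P.d + 2) * P.L : ℕ) : ℝ) * (P.L : ℝ) / (12800 * (((P.d + 2) * P.L : ℕ) : ℝ) ^ 2 * (P.L : ℝ))⁻¹) * B₀ * ε ≤ 1)
    (h2 : 64 * ε ≤ (12800 * (((P.d + 2) * P.L : ℕ) : ℝ) ^ 2 * (P.L : ℝ))⁻¹)
    -- the fibre letters (g0's `K0Stub1FibreTraceLetters.exists_fibreLetters`: `τ = ntr`, dualiser `ρ`, `M_ρ = N³`)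
    (τ : Matrix (Fin N) (Fin N) ℂ →L[ℂ] ℂ) (ρ : (Matrix (Fin N) (Fin N) ℂ →L[ℂ] ℂ) →L[ℂ] Matrix (Fin N) (Fin N) ℂ)
    (hρ : ∀ (ℓ' : Matrix (Fin N) (Fin N) ℂ →L[ℂ] ℂ) (X : Matrix (Fin N) (Fin N) ℂ), τ (ρ ℓ' * X) = ℓ' X)
    (hτ : ∀ a b : Matrix (Fin N) (Fin N) ℂ, τ (a * b) = τ (b * a)) (hτs : ∀ a : Matrix (Fin N) (Fin N) ℂ, τ (star a) = starRingEnd ℂ (τ a))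
    (hτ1 : ∀ X : Matrix (Fin N) (Fin N) ℂ, ‖τ X‖ ≤ ‖X‖) {Mρ : ℝ} (hMρ : 0 ≤ Mρ) (hρn : ∀ ℓ' : Matrix (Fin N) (Fin N) ℂ →L[ℂ] ℂ, ‖ρ ℓ'‖ ≤ Mρ * ‖ℓ'‖)
    -- the pairings (27) ∕ (66) and a `B`-symmetric multiplier (p598821's `exists_pairings_transposes_flatOps`: `BE`, `B`, `M_V`)
    (BE : (PBond P 0 → Matrix (Fin N) (Fin N) ℂ) →L[ℂ] (PBond P 0 → Matrix (Fin N) (Fin N) ℂ) →L[ℂ] ℂ)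
    (hBE : ∀ Y δ : PBond P 0 → Matrix (Fin N) (Fin N) ℂ, BE Y δ =
      bondPair (((P.L : ℝ))⁻¹ ^ k) P.d (τ : Matrix (Fin N) (Fin N) ℂ →ₗ[ℂ] ℂ) (fun μ x => Y ⟨x, μ⟩) (fun μ x => δ ⟨x, μ⟩))
    (B : (BondIdx Dm → Matrix (Fin N) (Fin N) ℂ) →L[ℂ] (BondIdx Dm → Matrix (Fin N) (Fin N) ℂ) →L[ℂ] ℂ)
    (hB : ∀ X X' : BondIdx Dm → Matrix (Fin N) (Fin N) ℂ, B X X' = ∑ t, τ (X t * X' t)) (hBsymm : ∀ a b, B a b = B b a)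
    (MV : (BondIdx Dm → Matrix (Fin N) (Fin N) ℂ) →L[ℂ] (BondIdx Dm → Matrix (Fin N) (Fin N) ℂ)) (hMsym : ∀ a b, B (MV a) b = B a (MV b))
    (Q : (PBond P 0 → Matrix (Fin N) (Fin N) ℂ) →L[ℂ] (BondIdx Dm → Matrix (Fin N) (Fin N) ℂ)) :
    let η : ℝ := ((P.L : ℝ)⁻¹) ^ k
    let C₂ : ℝ := (960 * (((P.d + 2) * P.L : ℕ) : ℝ) * (P.L : ℝ) / (12800 * (((P.d + 2) * P.L : ℕ) : ℝ) ^ 2 * (P.L : ℝ))⁻¹)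
    let Qlin := (fderiv ℂ (chartLog η Dm : (PBond P 0 → Matrix (Fin N) (Fin N) ℂ) → BondIdx Dm → Matrix (Fin N) (Fin N) ℂ) 0)
    ∃ (Qt : (BondIdx Dm → Matrix (Fin N) (Fin N) ℂ) →L[ℂ] (PBond P 0 → Matrix (Fin N) (Fin N) ℂ)) (Ht : (PBond P 0 → Matrix (Fin N) (Fin N) ℂ) →L[ℂ] (BondIdx Dm → Matrix (Fin N) (Fin N) ℂ))
      (Dfun : (PBond P 0 → Matrix (Fin N) (Fin N) ℂ) → (BondIdx Dm → Matrix (Fin N) (Fin N) ℂ))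
      (Dt : (PBond P 0 → Matrix (Fin N) (Fin N) ℂ) → ((BondIdx Dm → Matrix (Fin N) (Fin N) ℂ) →L[ℂ] (PBond P 0 → Matrix (Fin N) (Fin N) ℂ))),
      -- `Qt`, `Ht`
      (∀ X δ, BE (Qt X) δ = B X (Q δ)) ∧ (∀ Z X, BE Z (H X) = B (Ht Z) X) ∧
      -- the chart and its transposed derivative
      (∀ A' : PBond P 0 → Matrix (Fin N) (Fin N) ℂ, (∀ b, w 1 b * ‖A' b‖ < ε) →
        (∀ ρ' : ℝ, 0 ≤ ρ' → (∀ b, w 1 b * ‖A' b‖ ≤ ρ') → ∀ i, ‖Dfun A' i‖ ≤ 4 * C₂ * ρ' ^ 2) ∧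
        chartLog η Dm (A' - H (Dfun A')) - Qlin (A' - H (Dfun A')) = Dfun A' ∧
        chartLog η Dm (A' - H (Dfun A')) = Qlin A') ∧
      ContDiffOn ℂ ω Dfun {Y : PBond P 0 → Matrix (Fin N) (Fin N) ℂ | ∀ b, w 1 b * ‖Y b‖ < ε} ∧
      (∀ (A' : PBond P 0 → Matrix (Fin N) (Fin N) ℂ) X δ, BE (Dt A' X) δ = B X (fderiv ℂ Dfun A' δ)) ∧
      -- ★ THE W-SLOT MODULO THE NUMERIC LETTERS (with g0's site dictionary `e` of the V₀-current)
      ∀ (wB' : BondIdx Dm → ℝ) (O₁ q₀ θ₀ h₀ ℓ q : ℝ), 0 ≤ O₁ → 0 ≤ θ₀ → 0 ≤ h₀ → 1 + B₀ * (4 * C₂) * ε ≤ ℓ → 1 + B₁ * (4 * C₂) * ε ≤ ℓ → ℓ * ε ≤ 1 / 16 →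
        -- (3.132) for `M` (input block weight `1`, output block weight `wB′` — free, absorbing the volume factors of (66))
        (∀ (X : BondIdx Dm → Matrix (Fin N) (Fin N) ℂ) (s : ℝ), (∀ i, (1 : ℝ) * ‖X i‖ ≤ s) → ∀ i, wB' i * ‖MV X i‖ ≤ O₁ * s) →
        -- the column letter of `Qt`
        (∀ (X : BondIdx Dm → Matrix (Fin N) (Fin N) ℂ) (s : ℝ), (∀ i, wB' i * ‖X i‖ ≤ s) → ∀ b, w 3 b * ‖Qt X b‖ ≤ q₀ * s) →
        -- (73)ᵀ for `Dt`
        (∀ (A' : PBond P 0 → Matrix (Fin N) (Fin N) ℂ) (r : ℝ), (∀ b, w 1 b * ‖A' b‖ ≤ r) →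
          (∀ (b : PBond P 0) (ν : Fin P.d), w 2 b * (P.L : ℝ) ^ k * ‖A' ⟨b.src.shift ν, b.dir⟩ - A' b‖ ≤ r) → r < ε →
          ∀ (X : BondIdx Dm → Matrix (Fin N) (Fin N) ℂ) (s : ℝ), (∀ i, wB' i * ‖X i‖ ≤ s) → ∀ b, w 3 b * ‖Dt A' X b‖ ≤ θ₀ * r * s) →
        -- (46)ᵀ for `Ht`
        (∀ (Z : PBond P 0 → Matrix (Fin N) (Fin N) ℂ) (s : ℝ), (∀ b, w 3 b * ‖Z b‖ ≤ s) → ∀ i, wB' i * ‖Ht Z i‖ ≤ h₀ * s) →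
        -- the averaging letter of `Q`
        (∀ (A' : PBond P 0 → Matrix (Fin N) (Fin N) ℂ) (r : ℝ), (∀ b, w 1 b * ‖A' b‖ ≤ r) → ∀ i, (1 : ℝ) * ‖Q A' i‖ ≤ q * r) →
        ∃ (e : Site P 0 ≃ TSite P.d (fun _ => P.sitesPerDir 0)) (W : (PBond P 0 → Matrix (Fin N) (Fin N) ℂ) → (PBond P 0 → Matrix (Fin N) (Fin N) ℂ)),
          (∀ (x : Site P 0) (μ : Fin P.d), e (x.shift μ) = B9SectCLatticeCarrier.shift μ (e x)) ∧
          (∀ A' : PBond P 0 → Matrix (Fin N) (Fin N) ℂ, (∀ b, w 1 b * ‖A' b‖ < ε) →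
            (∀ (b : PBond P 0) (ν : Fin P.d), w 2 b * (P.L : ℝ) ^ k * ‖A' ⟨b.src.shift ν, b.dir⟩ - A' b‖ < ε) →
            HasFDerivAt (fun A : PBond P 0 → Matrix (Fin N) (Fin N) ℂ => 2⁻¹ * B (Dfun A) (MV (Dfun A)) - B (Q A) (MV (Dfun A))
                + V0 (LatticeFieldCalculus.shiftEquiv (P := P) (j := 0)) (fun _ _ => (1 : (Matrix (Fin N) (Fin N) ℂ)ˣ)) η P.d
                    (τ : Matrix (Fin N) (Fin N) ℂ →ₗ[ℂ] ℂ) (fun μ x => (A - H (Dfun A)) ⟨x, μ⟩))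
              (BE (W A')) A') ∧
          DifferentiableOn ℂ W {Y : PBond P 0 → Matrix (Fin N) (Fin N) ℂ | (∀ b, w 1 b * ‖Y b‖ < ε) ∧
            ∀ (b : PBond P 0) (ν : Fin P.d), w 2 b * (P.L : ℝ) ^ k * ‖Y ⟨b.src.shift ν, b.dir⟩ - Y b‖ < ε} ∧
          (∀ (Y : PBond P 0 → Matrix (Fin N) (Fin N) ℂ) (r : ℝ), r < ε → (∀ b, w 1 b * ‖Y b‖ ≤ r) →
            (∀ (b : PBond P 0) (ν : Fin P.d), w 2 b * (P.L : ℝ) ^ k * ‖Y ⟨b.src.shift ν, b.dir⟩ - Y b‖ ≤ r) →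
            ∀ b, w 3 b * ‖W Y b‖ ≤
              (θ₀ * O₁ * (4 * C₂ * ε + q) + q₀ * O₁ * (4 * C₂)
                + (1 + θ₀ * ε * h₀) * (((P.d - 1 : ℕ) : ℝ) * ((P.L : ℝ) ^ 2) ^ 3 * Mρ * (200 + 2 * (P.L : ℝ) ^ 2)) * ℓ ^ 2)
                * r ^ 2) := by
  intro η C₂ Qlin
  haveI : CompleteSpace (Matrix (Fin N) (Fin N) ℂ) := FiniteDimensional.complete ℂ _
  have hL0 : (0 : ℝ) < P.L := by exact_mod_cast P.L_pos
  have hRM1 : 1 ≤ R' * M := by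
    have h1 : 1 ≤ R' := by have := P.hL.2; omega
    exact le_trans h1 (Nat.le_mul_of_pos_right R' hM)
  have hC₂ : 0 ≤ C₂ := by
    show 0 ≤ (960 * (((P.d + 2) * P.L : ℕ) : ℝ) * (P.L : ℝ) / (12800 * (((P.d + 2) * P.L : ℕ) : ℝ) ^ 2 * (P.L : ℝ))⁻¹)
    positivity
  have hwpos : ∀ b, 0 < w 1 b := fun b => by rw [hw 1 b, pow_one]; positivity
  have hw2 : ∀ b, 0 ≤ w 2 b := fun b => by rw [hw 2 b]; positivity
  -- part 2 §3: the analytic chart for this `H`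
  obtain ⟨Dfun, hcd, -, hpt⟩ := exists_analytic_chartD_of_rightInverse (n := Fin N) k hR'L hM Dm hDk hAdm hw H hHinv hB₀ hHB hε h18 h2
  have h55 : ∀ A' : PBond P 0 → Matrix (Fin N) (Fin N) ℂ, (∀ b, w 1 b * ‖A' b‖ < ε) →
      ∀ ρ' : ℝ, 0 ≤ ρ' → (∀ b, w 1 b * ‖A' b‖ ≤ ρ') → ∀ i, ‖Dfun A' i‖ ≤ 4 * C₂ * ρ' ^ 2 := fun A' hA' => (hpt A' hA').1
  have h49 : ∀ A' : PBond P 0 → Matrix (Fin N) (Fin N) ℂ, (∀ b, w 1 b * ‖A' b‖ < ε) →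
      chartLog η Dm (A' - H (Dfun A')) - Qlin (A' - H (Dfun A')) = Dfun A' := fun A' hA' => (hpt A' hA').2.1
  -- part 3 §1: the chart block in the capstone's shapes
  obtain ⟨Dt, hD, hDt, hDd, h𝔇d, hDtd, h55', h57s, -⟩ :=
    chartBlock_of_solution (n := Fin N) k hR'L hM Dm hDk hAdm hw H hHinv hB₀ hHB hε h18 h2 Dfun h55 h49 τ ρ hρ BE hBE B hB
  -- part 1: the transposes of `Q` and `H` by formula
  obtain ⟨Qt, Ht, -, hQt, hHt, -, -, -, -, -⟩ :=
    exists_capstoneTransposes (β := BondIdx Dm) k hL0.ne' τ ρ hρ BE hBE B hB Q (LinearMap.toContinuousLinearMap H) (fun A' => fderiv ℂ Dfun A')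
  -- part 5: the one-step collar
  have hcollar := oneStepCollar_of_adm22 Dm hAdm hRM1
  refine ⟨Qt, Ht, Dfun, Dt, hQt, hHt, fun A' hA' => ⟨(hpt A' hA').1, (hpt A' hA').2.1, (hpt A' hA').2.2.1⟩, hcd, hDt, ?_⟩
  intro wB' O₁ q₀ θ₀ h₀ ℓ q hO₁ hθ₀ hh₀ hℓ₀ hℓ₁ hℓa h3132 hQt' h73t h46t hQ
  have hℓ0 : 0 ≤ ℓ := le_trans (by positivity) hℓ₀
  -- (57) ∧ (58): both halves of the capstone's `h57`, the gradient half from the gradient row of `H` and (55)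
  have h57 : ∀ (A' : PBond P 0 → Matrix (Fin N) (Fin N) ℂ) (r : ℝ), (∀ b, w 1 b * ‖A' b‖ ≤ r) →
      (∀ (b : PBond P 0) (ν : Fin P.d), w 2 b * (P.L : ℝ) ^ k * ‖A' ⟨b.src.shift ν, b.dir⟩ - A' b‖ ≤ r) → r < ε →
      (∀ b, w 1 b * ‖(A' - H (Dfun A')) b‖ ≤ ℓ * r) ∧
        ∀ (b : PBond P 0) (ν : Fin P.d),
          w 2 b * (P.L : ℝ) ^ k * ‖(A' - H (Dfun A')) ⟨b.src.shift ν, b.dir⟩ - (A' - H (Dfun A')) b‖ ≤ ℓ * r := by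
    intro A' r h0 h1 hr
    have hA'ε : ∀ b, w 1 b * ‖A' b‖ < ε := fun b => (h0 b).trans_lt hr
    refine ⟨fun b => ?_, fun b ν => ?_⟩
    · have hr0 : 0 ≤ r := le_trans (mul_nonneg (hwpos b).le (norm_nonneg _)) (h0 b)
      exact (h57s A' r h0 hr b).trans (mul_le_mul_of_nonneg_right hℓ₀ hr0)
    · have hr0 : 0 ≤ r := le_trans (mul_nonneg (hwpos b).le (norm_nonneg _)) (h0 b)
      have hDr : ∀ i, ‖Dfun A' i‖ ≤ 4 * C₂ * r ^ 2 := h55 A' hA'ε r hr0 h0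
      have hHg := hHgrad (Dfun A') (4 * C₂ * r ^ 2) (by positivity) hDr b ν
      have hsplit : (A' - H (Dfun A')) ⟨b.src.shift ν, b.dir⟩ - (A' - H (Dfun A')) b
          = (A' ⟨b.src.shift ν, b.dir⟩ - A' b) - (H (Dfun A') ⟨b.src.shift ν, b.dir⟩ - H (Dfun A') b) := by
        simp only [Pi.sub_apply]; abel
      rw [hsplit]
      calc w 2 b * (P.L : ℝ) ^ k * ‖(A' ⟨b.src.shift ν, b.dir⟩ - A' b) - (H (Dfun A') ⟨b.src.shift ν, b.dir⟩ - H (Dfun A') b)‖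
          ≤ w 2 b * (P.L : ℝ) ^ k * (‖A' ⟨b.src.shift ν, b.dir⟩ - A' b‖ + ‖H (Dfun A') ⟨b.src.shift ν, b.dir⟩ - H (Dfun A') b‖) :=
            mul_le_mul_of_nonneg_left (norm_sub_le _ _) (mul_nonneg (hw2 b) (by positivity))
        _ = w 2 b * (P.L : ℝ) ^ k * ‖A' ⟨b.src.shift ν, b.dir⟩ - A' b‖
              + w 2 b * (P.L : ℝ) ^ k * ‖H (Dfun A') ⟨b.src.shift ν, b.dir⟩ - H (Dfun A') b‖ := by ring
        _ ≤ r + B₁ * (4 * C₂ * r ^ 2) := add_le_add (h1 b ν) hHg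
        _ = (1 + B₁ * (4 * C₂) * r) * r := by ring
        _ ≤ (1 + B₁ * (4 * C₂) * ε) * r := by
            apply mul_le_mul_of_nonneg_right _ hr0
            have : B₁ * (4 * C₂) * r ≤ B₁ * (4 * C₂) * ε := mul_le_mul_of_nonneg_left hr.le (by positivity)
            linarith
        _ ≤ ℓ * r := mul_le_mul_of_nonneg_right hℓ₁ hr0
  -- the capstone
  obtain ⟨e, W₀, W, he, -, -, hcert, hWd, hWq⟩ :=
    exists_sectF_W_levOf P hd k (fun j => {x : Site P 0 | Dm.InOm j x}) hcollar w hw ρ τ hρ hτ hτs hτ1 BE hBE B hBsymm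
      Q MV hMsym (LinearMap.toContinuousLinearMap H) Qt hQt Ht hHt (a₃ := ε) Dfun (fun A' => fderiv ℂ Dfun A') Dt hD
      (fun A' _ _ X δ => hDt A' X δ) hDd hDtd
      (fun _ => (1 : ℝ)) wB' (fun _ => zero_le_one)
      (O₁ := O₁) (q₀ := q₀) (θ₀ := θ₀) (h₀ := h₀) (CD := 4 * C₂) (q := q) (ℓ := ℓ)
      hO₁ hθ₀ hh₀ (by positivity) hℓ0 hℓa h3132 hQt' h73t h46t h55' hQ h57
  refine ⟨e, W, he, hcert, hWd, fun Y r hr h0 h1 b => (hWq Y r hr h0 h1 b).trans ?_⟩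
  -- the fibre constant under the letter bounds (generic lemma of §0; no matrix op-norm instance is synthesised here)
  have hΘ : 0 ≤ 1 + θ₀ * ε * h₀ := by have := mul_nonneg (mul_nonneg hθ₀ hε.le) hh₀; linarith
  exact fibreSlotConst_le_of_letterBounds ρ τ hMρ hρn hτ1 (Nat.cast_nonneg _) (by positivity) (by positivity) hΘ (sq_nonneg _) (sq_nonneg _)

/-! ## §2  ★★★ The headline edition: `Q := Qlin`, the averaging letter discharged by part 4 (four numbers) -/

/-- ★★★ **THE W-SLOT OF SECT. F's `W = (δ∕δA′)V` AT THE RECORD's TRUE CONSTRAINT, MODULO FOUR NUMERIC LETTERS** (see the module docstring for the binder list and the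
conclusion; `Q := Qlin = D(chartLog η Dm)(0)`, `q = 240ℓ₀L` by `K0Stub1QlinSupLetter.letterQ_Qlin_of_adm22`).
[cite: Balaban1985Variational, Prop. 4 (97)-(98) pp.292-293, (157)-(158) p.302, (63) p.287, (87)-(90) p.291, (27) p.282, (45)-(50) p.285, (55)-(58) pp.286-287, (73) p.289; Balaban1984PropagatorsII, (2.2) p.224, Cor. 2.8 p.249] -/
theorem exists_sectF_W_atRecord_of_numericLetters (N : ℕ) [NeZero N] (P : Params) (hd : 4 ≤ P.d) (k : ℕ)
    [Fact ((0 : ℝ) < (P.L : ℝ))] [Fact ((0 : ℝ) < ((P.L : ℝ))⁻¹ ^ k)]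
    {R' M : ℕ} (hR'L : 2 * P.L ≤ R') (hM : 1 ≤ M) (Dm : Domains P) (hDk : Dm.k = k) (hAdm : Adm22 Dm R' M)
    {w : ℕ → PBond P 0 → ℝ} (hw : IsLevWeight P k Dm w)
    -- the right inverse `H` of the true linearisation with BOTH (46) rows (dag k0-s1-w1's p604736 gives the sup row; UST `ChartHInv.exists_rightInverse₂` the gradient row)
    (H : (BondIdx Dm → Matrix (Fin N) (Fin N) ℂ) →ₗ[ℂ] (PBond P 0 → Matrix (Fin N) (Fin N) ℂ))
    (hHinv : ∀ X, (fderiv ℂ (chartLog (((P.L : ℝ)⁻¹) ^ k) Dm : (PBond P 0 → Matrix (Fin N) (Fin N) ℂ) → BondIdx Dm → Matrix (Fin N) (Fin N) ℂ) 0) (H X) = X)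
    {B₀ : ℝ} (hB₀ : 0 ≤ B₀)
    (hHB : ∀ (X : BondIdx Dm → Matrix (Fin N) (Fin N) ℂ) (t : ℝ), 0 ≤ t → (∀ i, ‖X i‖ ≤ t) → ∀ b, w 1 b * ‖H X b‖ ≤ B₀ * t)
    {B₁ : ℝ} (hB₁ : 0 ≤ B₁)
    (hHgrad : ∀ (X : BondIdx Dm → Matrix (Fin N) (Fin N) ℂ) (t : ℝ), 0 ≤ t → (∀ i, ‖X i‖ ≤ t) →
      ∀ (b : PBond P 0) (ν : Fin P.d), w 2 b * (P.L : ℝ) ^ k * ‖H X ⟨b.src.shift ν, b.dir⟩ - H X b‖ ≤ B₁ * t)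
    -- the `ε`-window of dag-n07-w2's `N07ChartDDerivative` for this `B₀`
    {ε : ℝ} (hε : 0 < ε) (h18 : 18 * (960 * (((P.d + 2) * P.L : ℕ) : ℝ) * (P.L : ℝ) / (12800 * (((P.d + 2) * P.L : ℕ) : ℝ) ^ 2 * (P.L : ℝ))⁻¹) * B₀ * ε ≤ 1)
    (h2 : 64 * ε ≤ (12800 * (((P.d + 2) * P.L : ℕ) : ℝ) ^ 2 * (P.L : ℝ))⁻¹)
    -- the fibre letters (g0's `K0Stub1FibreTraceLetters.exists_fibreLetters`: `τ = ntr`, dualiser `ρ`, `M_ρ = N³`)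
    (τ : Matrix (Fin N) (Fin N) ℂ →L[ℂ] ℂ) (ρ : (Matrix (Fin N) (Fin N) ℂ →L[ℂ] ℂ) →L[ℂ] Matrix (Fin N) (Fin N) ℂ)
    (hρ : ∀ (ℓ' : Matrix (Fin N) (Fin N) ℂ →L[ℂ] ℂ) (X : Matrix (Fin N) (Fin N) ℂ), τ (ρ ℓ' * X) = ℓ' X)
    (hτ : ∀ a b : Matrix (Fin N) (Fin N) ℂ, τ (a * b) = τ (b * a)) (hτs : ∀ a : Matrix (Fin N) (Fin N) ℂ, τ (star a) = starRingEnd ℂ (τ a))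
    (hτ1 : ∀ X : Matrix (Fin N) (Fin N) ℂ, ‖τ X‖ ≤ ‖X‖) {Mρ : ℝ} (hMρ : 0 ≤ Mρ) (hρn : ∀ ℓ' : Matrix (Fin N) (Fin N) ℂ →L[ℂ] ℂ, ‖ρ ℓ'‖ ≤ Mρ * ‖ℓ'‖)
    -- the pairings (27) ∕ (66) and a `B`-symmetric multiplier (p598821's `exists_pairings_transposes_flatOps`: `BE`, `B`, `M_V`)
    (BE : (PBond P 0 → Matrix (Fin N) (Fin N) ℂ) →L[ℂ] (PBond P 0 → Matrix (Fin N) (Fin N) ℂ) →L[ℂ] ℂ)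
    (hBE : ∀ Y δ : PBond P 0 → Matrix (Fin N) (Fin N) ℂ, BE Y δ =
      bondPair (((P.L : ℝ))⁻¹ ^ k) P.d (τ : Matrix (Fin N) (Fin N) ℂ →ₗ[ℂ] ℂ) (fun μ x => Y ⟨x, μ⟩) (fun μ x => δ ⟨x, μ⟩))
    (B : (BondIdx Dm → Matrix (Fin N) (Fin N) ℂ) →L[ℂ] (BondIdx Dm → Matrix (Fin N) (Fin N) ℂ) →L[ℂ] ℂ)
    (hB : ∀ X X' : BondIdx Dm → Matrix (Fin N) (Fin N) ℂ, B X X' = ∑ t, τ (X t * X' t)) (hBsymm : ∀ a b, B a b = B b a)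
    (MV : (BondIdx Dm → Matrix (Fin N) (Fin N) ℂ) →L[ℂ] (BondIdx Dm → Matrix (Fin N) (Fin N) ℂ)) (hMsym : ∀ a b, B (MV a) b = B a (MV b)) :
    let η : ℝ := ((P.L : ℝ)⁻¹) ^ k
    let C₂ : ℝ := (960 * (((P.d + 2) * P.L : ℕ) : ℝ) * (P.L : ℝ) / (12800 * (((P.d + 2) * P.L : ℕ) : ℝ) ^ 2 * (P.L : ℝ))⁻¹)
    let Qlin := (fderiv ℂ (chartLog η Dm : (PBond P 0 → Matrix (Fin N) (Fin N) ℂ) → BondIdx Dm → Matrix (Fin N) (Fin N) ℂ) 0)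
    ∃ (Qt : (BondIdx Dm → Matrix (Fin N) (Fin N) ℂ) →L[ℂ] (PBond P 0 → Matrix (Fin N) (Fin N) ℂ)) (Ht : (PBond P 0 → Matrix (Fin N) (Fin N) ℂ) →L[ℂ] (BondIdx Dm → Matrix (Fin N) (Fin N) ℂ))
      (Dfun : (PBond P 0 → Matrix (Fin N) (Fin N) ℂ) → (BondIdx Dm → Matrix (Fin N) (Fin N) ℂ))
      (Dt : (PBond P 0 → Matrix (Fin N) (Fin N) ℂ) → ((BondIdx Dm → Matrix (Fin N) (Fin N) ℂ) →L[ℂ] (PBond P 0 → Matrix (Fin N) (Fin N) ℂ))),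
      -- `Qt`, `Ht`
      (∀ X δ, BE (Qt X) δ = B X (Qlin δ)) ∧ (∀ Z X, BE Z (H X) = B (Ht Z) X) ∧
      -- the chart and its transposed derivative
      (∀ A' : PBond P 0 → Matrix (Fin N) (Fin N) ℂ, (∀ b, w 1 b * ‖A' b‖ < ε) →
        (∀ ρ' : ℝ, 0 ≤ ρ' → (∀ b, w 1 b * ‖A' b‖ ≤ ρ') → ∀ i, ‖Dfun A' i‖ ≤ 4 * C₂ * ρ' ^ 2) ∧
        chartLog η Dm (A' - H (Dfun A')) - Qlin (A' - H (Dfun A')) = Dfun A' ∧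
        chartLog η Dm (A' - H (Dfun A')) = Qlin A') ∧
      ContDiffOn ℂ ω Dfun {Y : PBond P 0 → Matrix (Fin N) (Fin N) ℂ | ∀ b, w 1 b * ‖Y b‖ < ε} ∧
      (∀ (A' : PBond P 0 → Matrix (Fin N) (Fin N) ℂ) X δ, BE (Dt A' X) δ = B X (fderiv ℂ Dfun A' δ)) ∧
      -- ★ THE W-SLOT MODULO THE NUMERIC LETTERS (with g0's site dictionary `e` of the V₀-current)
      ∀ (wB' : BondIdx Dm → ℝ) (O₁ q₀ θ₀ h₀ ℓ : ℝ), 0 ≤ O₁ → 0 ≤ θ₀ → 0 ≤ h₀ → 1 + B₀ * (4 * C₂) * ε ≤ ℓ → 1 + B₁ * (4 * C₂) * ε ≤ ℓ → ℓ * ε ≤ 1 / 16 →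
        -- (3.132) for `M` (input block weight `1`, output block weight `wB′` — free, absorbing the volume factors of (66))
        (∀ (X : BondIdx Dm → Matrix (Fin N) (Fin N) ℂ) (s : ℝ), (∀ i, (1 : ℝ) * ‖X i‖ ≤ s) → ∀ i, wB' i * ‖MV X i‖ ≤ O₁ * s) →
        -- the column letter of `Qt`
        (∀ (X : BondIdx Dm → Matrix (Fin N) (Fin N) ℂ) (s : ℝ), (∀ i, wB' i * ‖X i‖ ≤ s) → ∀ b, w 3 b * ‖Qt X b‖ ≤ q₀ * s) →
        -- (73)ᵀ for `Dt`
        (∀ (A' : PBond P 0 → Matrix (Fin N) (Fin N) ℂ) (r : ℝ), (∀ b, w 1 b * ‖A' b‖ ≤ r) →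
          (∀ (b : PBond P 0) (ν : Fin P.d), w 2 b * (P.L : ℝ) ^ k * ‖A' ⟨b.src.shift ν, b.dir⟩ - A' b‖ ≤ r) → r < ε →
          ∀ (X : BondIdx Dm → Matrix (Fin N) (Fin N) ℂ) (s : ℝ), (∀ i, wB' i * ‖X i‖ ≤ s) → ∀ b, w 3 b * ‖Dt A' X b‖ ≤ θ₀ * r * s) →
        -- (46)ᵀ for `Ht`
        (∀ (Z : PBond P 0 → Matrix (Fin N) (Fin N) ℂ) (s : ℝ), (∀ b, w 3 b * ‖Z b‖ ≤ s) → ∀ i, wB' i * ‖Ht Z i‖ ≤ h₀ * s) →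
        ∃ (e : Site P 0 ≃ TSite P.d (fun _ => P.sitesPerDir 0)) (W : (PBond P 0 → Matrix (Fin N) (Fin N) ℂ) → (PBond P 0 → Matrix (Fin N) (Fin N) ℂ)),
          (∀ (x : Site P 0) (μ : Fin P.d), e (x.shift μ) = B9SectCLatticeCarrier.shift μ (e x)) ∧
          (∀ A' : PBond P 0 → Matrix (Fin N) (Fin N) ℂ, (∀ b, w 1 b * ‖A' b‖ < ε) →
            (∀ (b : PBond P 0) (ν : Fin P.d), w 2 b * (P.L : ℝ) ^ k * ‖A' ⟨b.src.shift ν, b.dir⟩ - A' b‖ < ε) →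
            HasFDerivAt (fun A : PBond P 0 → Matrix (Fin N) (Fin N) ℂ => 2⁻¹ * B (Dfun A) (MV (Dfun A)) - B (Qlin A) (MV (Dfun A))
                + V0 (LatticeFieldCalculus.shiftEquiv (P := P) (j := 0)) (fun _ _ => (1 : (Matrix (Fin N) (Fin N) ℂ)ˣ)) η P.d
                    (τ : Matrix (Fin N) (Fin N) ℂ →ₗ[ℂ] ℂ) (fun μ x => (A - H (Dfun A)) ⟨x, μ⟩))
              (BE (W A')) A') ∧
          DifferentiableOn ℂ W {Y : PBond P 0 → Matrix (Fin N) (Fin N) ℂ | (∀ b, w 1 b * ‖Y b‖ < ε) ∧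
            ∀ (b : PBond P 0) (ν : Fin P.d), w 2 b * (P.L : ℝ) ^ k * ‖Y ⟨b.src.shift ν, b.dir⟩ - Y b‖ < ε} ∧
          (∀ (Y : PBond P 0 → Matrix (Fin N) (Fin N) ℂ) (r : ℝ), r < ε → (∀ b, w 1 b * ‖Y b‖ ≤ r) →
            (∀ (b : PBond P 0) (ν : Fin P.d), w 2 b * (P.L : ℝ) ^ k * ‖Y ⟨b.src.shift ν, b.dir⟩ - Y b‖ ≤ r) →
            ∀ b, w 3 b * ‖W Y b‖ ≤
              (θ₀ * O₁ * (4 * C₂ * ε + 240 * (((P.d + 2) * P.L : ℕ) : ℝ) * (P.L : ℝ)) + q₀ * O₁ * (4 * C₂)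
                + (1 + θ₀ * ε * h₀) * (((P.d - 1 : ℕ) : ℝ) * ((P.L : ℝ) ^ 2) ^ 3 * Mρ * (200 + 2 * (P.L : ℝ) ^ 2)) * ℓ ^ 2)
                * r ^ 2) := by
  intro η C₂ Qlin
  obtain ⟨Qt, Ht, Dfun, Dt, hQt, hHt, hpt, hcd, hDt, main⟩ :=
    exists_sectF_W_atRecord_of_numericLetters_anyQ N P hd k hR'L hM Dm hDk hAdm hw H hHinv hB₀ hHB hB₁ hHgrad hε h18 h2 τ ρ hρ hτ hτs hτ1 hMρ hρn
      BE hBE B hB hBsymm MV hMsym Qlin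
  refine ⟨Qt, Ht, Dfun, Dt, hQt, hHt, hpt, hcd, hDt, ?_⟩
  intro wB' O₁ q₀ θ₀ h₀ ℓ hO₁ hθ₀ hh₀ hℓ₀ hℓ₁ hℓa h3132 hQt' h73t h46t
  -- part 4: the averaging letter of `Qlin`, `q = 240ℓ₀L`
  exact main wB' O₁ q₀ θ₀ h₀ ℓ (240 * (((P.d + 2) * P.L : ℕ) : ℝ) * (P.L : ℝ)) hO₁ hθ₀ hh₀ hℓ₀ hℓ₁ hℓa h3132 hQt' h73t h46t
    (letterQ_Qlin_of_adm22 (𝔸 := Matrix (Fin N) (Fin N) ℂ) k hR'L hM Dm hDk hAdm hw)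

-- A6 (non-vacuity of the parameter block): `H` with `hHinv` + sup row = dag k0-s1-w1's `exists_rightInverse_chartLog_of_flatH` (gradient row: the record wrapper of UST
-- `ChartHInv.exists_rightInverse₂`, located follow-up); fibre letters with `M_ρ = N³` = g0's `K0Stub1FibreTraceLetters.exists_fibreLetters`; `BE`, `B` (symmetric for a
-- tracial `τ`) and a `B`-symmetric `M_V` = p598821's `K0Stub1PairingsAtExtensions.exists_pairings_transposes_flatOps`; the `ε`-window = dag-n07-w2's
-- `N07ChartDDerivative.exists_eps_chartDDeriv`; admissible families with weights = `N07ChartDOfRecord.chartBinders_inhabited` or dag-n07-e's `cubeDomains` (39b).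

end Summit.QuantumFields.YangMills.Theorems.K0Stub1SectFWSlotAtRecord

end
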